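import Summits.ABC.IUTFork.LDHCor312
import Literature.IUT.LogVolume.HullVolumeAssembly
import HarnessLib

/-!
# The fork at [IUTchIII] Corollary 3.12, L-DH level: the multiradial ESTIMATE `EstimateDH` and the
# log-volume `−|log(Θ)|` REDUCED to per-summand component bounds ([IUTchIV] Thm. 1.10 Steps (iv)–(viii))

Record-only file (D-0012) of the abc-iut cell (campaign-S seat abc-iut-S2, slice TRANCHE-T1 P03 "everything
volumetric … waits on these containers"; `plan/LDH-SPEC.md` D9′ = "the COMPUTABLE half:
`ln ν̄_𝕃(hull(U_Θ)) ≤ (explicit)` — IUT4 Thm 1.10 Steps (iv)–(x)"); TAKES NO SIDE. Over abc-iut-c312-3's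
`Summit.ABC.IUTFork.DHData` (`LDHCor312.lean`: the Dupuy–Hilado data for Cor. 3.12, `negLogThetaDH =
ln ν̄_𝕃(hull(U_Θ))`, the HYPOTHESIS `EstimateDH δ : ln ν̄_𝕃(hull(U_Θ)) ≤ ln ν̄_𝕃(O_𝕃(−P_Θ)) + δ` — "[IUTchIV]
Thm. 1.10 Steps (iv)–(x) would supply `δ`") and the model-independent assembly theorems of
`Literature/IUT/LogVolume/HullVolumeAssembly.lean` (Dupuy–Hilado's `ln ν̄` = Mochizuki's procession-normalized
weighted average of [IUTchIV] Prop. 1.7 / Rmk. 1.7.1 / Thm. 1.10 Step (iv)).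

Mochizuki, *Inter-universal Teichmüller theory IV* (RIMS Apr-2020 ms = PRIMS **57** (2021)), proof of
Thm. 1.10, Step (iv) p. 26–27: "it suffices to … estimate the component of this log-volume … for each `j` …
and then comput[e] the average, over `j`", "for each collection `{v_i}_{i∈S±_{j+1}}` … estimate the component
… and then compute the weighted average"; Step (viii) p. 30: "it suffices to sum over `v_ℚ ∈ 𝕍_ℚ` the various
local “procession-normalized upper bounds” obtained in Steps (v), (vi), (vii)". Dupuy–Hilado,
arXiv:2004.13228, §1 (1.1), Def. 3.6.3, §3.9, §4.10–4.12.

WHAT IS PROVED, for any `D : DHData F` (nothing asserted about whether its hypotheses hold):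
* `negLogThetaDH_eq_sum_procAvg_wavg` — `−|log(Θ)|_DH = Σ_{p ∈ T} procAvg_{j} wavg_{v⃗} log μ̄_{v⃗}(hull(U_Θ)_{p,j,v⃗})`
  for any local data `D_p` (abc-iut-S3's `Thm110Local.DstLocal`) with the weights `λ_v = [F_v:ℚ_p]`: the
  quantity of (1.1) IS the Step (iv)/(viii) double average of the hull's components;
* `logμ_regionΘ_eq_lnAbs` — the components of the bare region: `log μ̄_{v⃗}(O_𝕃(−P_Θ)_{p,j,v⃗}) = ln|t_{Θ,j,v_j}|_p`
  (DH (3.7)/(3.4); the "`−λ·log(p)`"-type term of Step (v) at the last slot);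
* `estimateDH_of_componentBounds` / `estimateDH_of_componentBounds_wavg` — **D9′ REDUCED TO SUMMANDS**: if for
  every `p ∈ T`, `1 ≤ j ≤ l⋇` and every collection `v⃗ ∈ V(F)_p^{j+1}` the hull component is bounded by the bare
  component plus a discrepancy, `log μ̄(hull(U_Θ)_{p,j,v⃗}) ≤ log μ̄(O_𝕃(−P_Θ)_{p,j,v⃗}) + δ(p,j,v⃗)`, then
  `EstimateDH (Σ_p procAvg_j wavg_{v⃗} δ)` HOLDS — so the hypothesis `EstimateDH` is discharged by, and only by,
  the per-summand inequalities of Steps (v)/(vi) at the packet model `D.M` (Props. 1.2, 1.4 (iii)/(iv), (R4),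
  the (Ind1)(Ind2)(Ind3) containments), which are NOT proved here;
* `estimateDH_of_lnAbs_bounds` — the same with the bare component written as `ln|t_{Θ,j,v_j}|_p`;
* `negLogThetaDH_le_sum_dst` / `negLogThetaDH_eq_sum_dst_add` — the `LocalProofData.negLogTheta_le` SHAPE
  (abc-iut-S3, `Theorem110Assembly.lean`): if off a set `dst ⊆ T` of distinguished primes the hull components
  have `log μ̄ ≤ 0` (Step (vi): "Such an upper bound “0” is given in the final equality of Proposition 1.4,
  (iv)"), then `−|log(Θ)|_DH = Σ_{p ∈ dst} procAvg_j wavg_{v⃗} vol + Z` with `vol :=` the hull components and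
  `Z ≤ 0` (no archimedean term at the L-DH level);
* `gap_le_of_cor312DH_of_componentBounds` — composing with c312-3's squeeze: (1.1) AND the per-summand bounds
  give `deĝ̲_lgp(P_Θ) − deĝ̲(P_q) ≤ Σ_p procAvg_j wavg δ`.
[cite: DupuyHilado2025, §1 (1.1), Def. 3.6.3, §3.9, §4.10–4.12] [claim: Mochizuki2012, status: disputed]
Deliberately NOT here: the per-summand bounds (campaign S / c312 model seats), the normalisation dictionary with
`Thm110Numerics` (`−|log(Θ)|`, `|log(q)|` as printed in [IUTchIV] Thm. 1.10 vs `ln ν̄_𝕃`, `deĝ̲`), archimedean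
primes, any judgement on [IUTchIII] Cor. 3.12. Typed ≠ endorsed.
-/

noncomputable section

namespace Summit.ABC.IUTFork

namespace DHData

open Finset Literature.IUT.LogVolume Literature.IUT.LogVolume.Thm110Local NumberField IsDedekindDomain

variable {F : Type} [Field F] [NumberField F] (D : DHData F)

/-! ## `−|log(Θ)|_DH` as the Step (iv)/(viii) double average of the hull components -/

/-- **`−|log(Θ)|_DH = Σ_{p ∈ T} procAvg_j wavg_{v⃗} log μ̄_{v⃗}(hull(U_Θ)_{p,j,v⃗})`** for any family of local data
`D_p` with the weights `λ_v = [F_v:ℚ_p]` ([IUTchIV] Rmk. 1.7.1): the log-volume of (1.1) is the sum over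
primes of the procession average of the weighted averages over collections of the components of the hull
(Step (iv) p. 26–27, Step (viii) p. 30). [cite: DupuyHilado2025, §1 (1.1), Def. 3.6.3] -/
theorem negLogThetaDH_eq_sum_procAvg_wavg (Dloc : (p : ℕ) → DstLocal (placesOver F p))
    (hlam : ∀ p ∈ D.T, ∀ v, (Dloc p).lam v = localDegree F v.1) :
    D.negLogThetaDH =
      ∑ p ∈ D.T, procAvg D.X.lstar (fun j =>
        @DstLocal.wavg _ _ (Dloc p) (j + 1) (fun e => D.M.logμ (D.M.hullUTheta D.ind3 p j e))) :=
  D.M.lnνL_eq_sum_procAvg_wavg D.X.lstar D.T D.T_prime Dloc hlam _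

/-- The components of the bare region `O_𝕃(−P_Θ)` in the degrees `1 ≤ j ≤ l⋇`: `log μ̄_{v⃗}(t_{Θ,j,v_j}·O_{v⃗}) =
ln|t_{Θ,j,v_j}|_p` (DH (3.7) with (3.4): the theta value at the LAST slot `v_j`; the "`λ`" of Step (v) p. 27,
"“λ” to be … “ord(−)” of the element `q_{v_j}^{j²}`"). [cite: DupuyHilado2025, §3.7, §3.9] -/
theorem logμ_regionΘ_eq_lnAbs (i : Fin D.X.lstar) (p : ℕ) (e : Fin ((i : ℕ) + 1 + 1) → placesOver F p) :
    D.M.logμ (D.M.region D.tΘ p ((i : ℕ) + 1) e) = D.M.lnAbs (D.tΘ i p (e (Fin.last _))) := by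
  rw [D.M.region_succ D.tΘ i p e, D.M.logμ_peel_O]

/-! ## D9′ reduced to summands: `EstimateDH` from per-summand component bounds -/

/-- **`EstimateDH` from per-summand component bounds.** If for every `p ∈ T`, every procession degree
`1 ≤ j ≤ l⋇` and every collection `v⃗ ∈ V(F)_p^{j+1}` the component of `hull(U_Θ)` is bounded by the component of
the bare Θ-region plus a discrepancy `δ(p,j,v⃗)`, then
`ln ν̄_𝕃(hull(U_Θ)) ≤ ln ν̄_𝕃(O_𝕃(−P_Θ)) + Σ_{p ∈ T} (1/l⋇)·Σ_{j} Σ_{v⃗} δ(p,j,v⃗)·Π_k Pr(v_k)`, i.e. `EstimateDH`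
holds with that constant ("it suffices to sum over `v_ℚ ∈ 𝕍_ℚ` the various local … upper bounds", Step (viii)).
[claim: Mochizuki2012, status: disputed] -/
theorem estimateDH_of_componentBounds
    (δ : (p j : ℕ) → (Fin (j + 1) → placesOver F p) → ℝ)
    (h : ∀ p ∈ D.T, ∀ j, 1 ≤ j → j ≤ D.X.lstar → ∀ e,
      D.M.logμ (D.M.hullUTheta D.ind3 p j e) ≤ D.M.logμ (D.M.region D.tΘ p j e) + δ p j e) :
    D.EstimateDH (∑ p ∈ D.T, (1 / (D.X.lstar : ℝ)) *
      ∑ i : Fin D.X.lstar, ∑ e, δ p ((i : ℕ) + 1) e * ∏ k, weight F (e k).1) :=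
  D.M.lnνL_le_add_sum D.X.lstar D.T δ h

/-- **`EstimateDH` from per-summand component bounds, Step (iv) vocabulary**: the constant written as
`Σ_{p ∈ T} procAvg_j wavg_{v⃗} δ(p,j,v⃗)` for local data `D_p` with `λ_v = [F_v:ℚ_p]` (Prop. 1.7 / Rmk. 1.7.1 /
Thm. 1.10 Step (iv)). [claim: Mochizuki2012, status: disputed] -/
theorem estimateDH_of_componentBounds_wavg (Dloc : (p : ℕ) → DstLocal (placesOver F p))
    (hlam : ∀ p ∈ D.T, ∀ v, (Dloc p).lam v = localDegree F v.1)
    (δ : (p j : ℕ) → (Fin (j + 1) → placesOver F p) → ℝ)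
    (h : ∀ p ∈ D.T, ∀ j, 1 ≤ j → j ≤ D.X.lstar → ∀ e,
      D.M.logμ (D.M.hullUTheta D.ind3 p j e) ≤ D.M.logμ (D.M.region D.tΘ p j e) + δ p j e) :
    D.EstimateDH (∑ p ∈ D.T, procAvg D.X.lstar (fun j => @DstLocal.wavg _ _ (Dloc p) (j + 1) (δ p j))) :=
  D.M.lnνL_le_add_sum_procAvg_wavg D.X.lstar D.T D.T_prime Dloc hlam δ h

/-- **`EstimateDH` from per-summand bounds against the theta values**: if in every degree `j = i+1`
(`i < l⋇`) and every collection the hull component satisfies `log μ̄(hull(U_Θ)_{p,j,v⃗}) ≤ ln|t_{Θ,j,v_j}|_p +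
δ(p,j,v⃗)` — the Step (v) shape "`(−λ + …)·log(p)`" with `λ = ord(q_{v_j}^{j²})` at the last slot — then
`EstimateDH (Σ_p procAvg_j wavg δ)`. [claim: Mochizuki2012, status: disputed] -/
theorem estimateDH_of_lnAbs_bounds (Dloc : (p : ℕ) → DstLocal (placesOver F p))
    (hlam : ∀ p ∈ D.T, ∀ v, (Dloc p).lam v = localDegree F v.1)
    (δ : (p j : ℕ) → (Fin (j + 1) → placesOver F p) → ℝ)
    (h : ∀ p ∈ D.T, ∀ (i : Fin D.X.lstar) (e : Fin ((i : ℕ) + 1 + 1) → placesOver F p),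
      D.M.logμ (D.M.hullUTheta D.ind3 p ((i : ℕ) + 1) e) ≤
        D.M.lnAbs (D.tΘ i p (e (Fin.last _))) + δ p ((i : ℕ) + 1) e) :
    D.EstimateDH (∑ p ∈ D.T, procAvg D.X.lstar (fun j => @DstLocal.wavg _ _ (Dloc p) (j + 1) (δ p j))) := by
  refine D.estimateDH_of_componentBounds_wavg Dloc hlam δ fun p hp j hj1 hj2 e => ?_
  obtain ⟨i, rfl⟩ : ∃ i : ℕ, j = i + 1 := ⟨j - 1, by omega⟩
  have hi : i < D.X.lstar := by omega
  have := h p hp ⟨i, hi⟩ e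
  rwa [D.logμ_regionΘ_eq_lnAbs ⟨i, hi⟩ p e]

/-- **Composing with c312-3's squeeze**: (1.1) (`Cor312DH`) together with the per-summand component bounds
gives `deĝ̲_lgp(P_Θ) − deĝ̲(P_q) ≤ Σ_{p ∈ T} procAvg_j wavg_{v⃗} δ` (`gap_le_of_cor312DH_of_estimateDH`).
[claim: Mochizuki2012, status: disputed] -/
theorem gap_le_of_cor312DH_of_componentBounds (h1 : D.Cor312DH)
    (Dloc : (p : ℕ) → DstLocal (placesOver F p))
    (hlam : ∀ p ∈ D.T, ∀ v, (Dloc p).lam v = localDegree F v.1)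
    (δ : (p j : ℕ) → (Fin (j + 1) → placesOver F p) → ℝ)
    (h : ∀ p ∈ D.T, ∀ j, 1 ≤ j → j ≤ D.X.lstar → ∀ e,
      D.M.logμ (D.M.hullUTheta D.ind3 p j e) ≤ D.M.logμ (D.M.region D.tΘ p j e) + δ p j e) :
    LgpDivisor.ndegLgp D.X.thetaPilot - FinDivisor.ndeg F D.X.qPilot ≤
      ∑ p ∈ D.T, procAvg D.X.lstar (fun j => @DstLocal.wavg _ _ (Dloc p) (j + 1) (δ p j)) :=
  D.gap_le_of_cor312DH_of_estimateDH h1 (D.estimateDH_of_componentBounds_wavg Dloc hlam δ h)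

/-! ## The `LocalProofData.negLogTheta_le` shape: splitting off the distinguished primes -/

/-- **Step (vi) assembled for `−|log(Θ)|_DH`**: if off a set `dst ⊆ T` of distinguished primes every component
of `hull(U_Θ)` in the degrees `1 ≤ j ≤ l⋇` has `log μ̄ ≤ 0`, then
`−|log(Θ)|_DH ≤ Σ_{p ∈ dst} procAvg_j wavg_{v⃗} log μ̄(hull(U_Θ)_{p,j,v⃗})` for local data with `λ_v = [F_v:ℚ_p]`.
[claim: Mochizuki2012, status: disputed] -/
theorem negLogThetaDH_le_sum_dst {dst : Finset ℕ} (hdst : dst ⊆ D.T)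
    (Dloc : (p : ℕ) → DstLocal (placesOver F p))
    (hlam : ∀ p ∈ dst, ∀ v, (Dloc p).lam v = localDegree F v.1)
    (hoff : ∀ p ∈ D.T, p ∉ dst → ∀ j, 1 ≤ j → j ≤ D.X.lstar → ∀ e,
      D.M.logμ (D.M.hullUTheta D.ind3 p j e) ≤ 0) :
    D.negLogThetaDH ≤
      ∑ p ∈ dst, procAvg D.X.lstar (fun j =>
        @DstLocal.wavg _ _ (Dloc p) (j + 1) (fun e => D.M.logμ (D.M.hullUTheta D.ind3 p j e))) :=
  D.M.lnνL_le_sum_dst_procAvg_wavg D.X.lstar hdst D.T_prime Dloc hlam hoff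

/-- … and as the identity with a nonpositive remainder: `−|log(Θ)|_DH = Σ_{p ∈ dst} procAvg_j wavg_{v⃗} vol + Z`,
`vol :=` the hull components, `Z ≤ 0` — the fields `vol`, `Z`, `hZ`, `negLogTheta_le` (without the archimedean
term) of `Literature.IUT.LogVolume.Thm110Numerics.LocalProofData` at the L-DH level.
[claim: Mochizuki2012, status: disputed] -/
theorem negLogThetaDH_eq_sum_dst_add {dst : Finset ℕ} (hdst : dst ⊆ D.T)
    (Dloc : (p : ℕ) → DstLocal (placesOver F p))
    (hlam : ∀ p ∈ dst, ∀ v, (Dloc p).lam v = localDegree F v.1)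
    (hoff : ∀ p ∈ D.T, p ∉ dst → ∀ j, 1 ≤ j → j ≤ D.X.lstar → ∀ e,
      D.M.logμ (D.M.hullUTheta D.ind3 p j e) ≤ 0) :
    ∃ Z : ℝ, Z ≤ 0 ∧ D.negLogThetaDH =
      (∑ p ∈ dst, procAvg D.X.lstar (fun j =>
        @DstLocal.wavg _ _ (Dloc p) (j + 1) (fun e => D.M.logμ (D.M.hullUTheta D.ind3 p j e)))) + Z :=
  D.M.lnνL_eq_sum_dst_procAvg_wavg_add D.X.lstar hdst D.T_prime Dloc hlam hoff

/-! ## D9′'s conclusion shape at the L-DH level, from per-prime weighted-average / per-collection bounds -/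

/-- Per-prime procession bound from the printed weighted-average hypotheses (a local copy of abc-iut-S3's
`Thm110Local.DstLocal.procAvg_le_of_wavg_bounds`, appended to `Theorem110LocalBounds.lean` at 20:49Z, kept
private here so that this file does not depend on the order in which the two oleans are built). [folklore] -/
private theorem procAvg_le_of_wavg_bounds_aux {E : Type*} [Fintype E] [Nonempty E] (Dl : DstLocal E)
    {lh : ℕ} (hlh : 2 ≤ lh) {lstar : ℝ} (hlstar : 0 ≤ lstar)
    (vol : (j : ℕ) → (Fin (j + 1) → E) → ℝ)
    (hwavg : ∀ j, 1 ≤ j → j ≤ lh → Dl.wavg (j + 1) (vol j) ≤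
      ((j : ℝ) + 1) * Dl.avg Dl.logDK - (j : ℝ) ^ 2 / (2 * (2 * (lh : ℝ) + 1)) * Dl.avg Dl.logQ + Dl.logp
        + 4 * ((j : ℝ) + 1) * (Dl.iota * lstar)) :
    procAvg lh (fun j => Dl.wavg (j + 1) (vol j)) ≤
      ((2 * (lh : ℝ) + 1) + 1) / 4 * ((1 + 4 / (2 * (lh : ℝ) + 1)) * Dl.avg Dl.logDK
        - 1 / 6 * Dl.avg Dl.logQ + 4 / (2 * (lh : ℝ) + 1) * Dl.logp
        + 20 / 3 * (Dl.iota * lstar)) := by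
  have hlh1 : 1 ≤ lh := by omega
  have hle : procAvg lh (fun j => Dl.wavg (j + 1) (vol j)) ≤
      procAvg lh (fun j : ℕ => ((j : ℝ) + 1) * Dl.avg Dl.logDK
        - (j : ℝ) ^ 2 / (2 * (2 * (lh : ℝ) + 1)) * Dl.avg Dl.logQ + Dl.logp
        + 4 * ((j : ℝ) + 1) * (Dl.iota * lstar)) := by
    unfold procAvg
    apply mul_le_mul_of_nonneg_left _ (by positivity)
    refine Finset.sum_le_sum fun j hj => ?_
    rw [Finset.mem_Icc] at hj
    exact hwavg j hj.1 hj.2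
  refine le_trans hle ?_
  rw [procAvg_linear' hlh1]
  have hA : 0 ≤ Dl.avg Dl.logDK := by
    unfold DstLocal.avg Literature.Algebra.PolynomialIdentities.WeightedAverage.betaAvg
      Literature.Algebra.PolynomialIdentities.WeightedAverage.betaTotal
    exact div_nonneg (Finset.sum_nonneg fun v _ => mul_nonneg (Dl.logDK_nonneg v) (Dl.lam_pos v).le)
      (Literature.Algebra.PolynomialIdentities.WeightedAverage.lamTotal_pos Dl.lam_pos).le
  have hl5 : (5 : ℝ) ≤ 2 * (lh : ℝ) + 1 := by
    have : (2 : ℝ) ≤ lh := by exact_mod_cast hlh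
    linarith
  exact procNormalized_le (B := Dl.avg Dl.logQ) hl5 hA Dl.logp_nonneg (mul_nonneg Dl.iota_nonneg hlstar)

/-- Summing a fixed linear form over a finite index set. [folklore] -/
private theorem sum_lin {ι : Type*} (s : Finset ι) (a b c d : ι → ℝ) (k k₁ k₂ k₃ k₄ : ℝ) :
    ∑ v ∈ s, k * (k₁ * a v - k₂ * b v + k₃ * c v + k₄ * d v) =
      k * (k₁ * ∑ v ∈ s, a v - k₂ * ∑ v ∈ s, b v + k₃ * ∑ v ∈ s, c v + k₄ * ∑ v ∈ s, d v) := by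
  rw [Finset.mul_sum, Finset.mul_sum, Finset.mul_sum, Finset.mul_sum, ← Finset.sum_sub_distrib,
    ← Finset.sum_add_distrib, ← Finset.sum_add_distrib, Finset.mul_sum]

/-- **The nonarchimedean part of [IUTchIV] Thm. 1.10's bound for `−|log(Θ)|`, at the L-DH level, from the
PRINTED per-prime hypotheses.** Let `dst ⊆ T` be the distinguished primes, `D_p` local data at `p ∈ dst`
(`λ_v = [F_v:ℚ_p]`, `log(𝔡^K_v)`, `log(q_v)`, `log(p)`, `ι_p`) and `l*_mod ≥ 0`. Suppose (Step (v), final display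
of p. 28, "the resulting “weighted average upper bound” is given by `(j+1)·log(𝔡^K_{v_ℚ}) − (j²/2l)·log(q_{v_ℚ}) +
log(𝔰^ℚ_{v_ℚ}) + 4(j+1)·l*_mod·log(𝔰^≤_{v_ℚ})`") that for `p ∈ dst`, `1 ≤ j ≤ l⋇` the weighted average of the hull
components obeys that bound with `l = 2l⋇+1`, and (Step (vi)) that off `dst` the hull components have
`log μ̄ ≤ 0`. Then
`−|log(Θ)|_DH ≤ (l+1)/4·{(1+4/l)·Σ_p log(𝔡^K_p) − (1/6)·Σ_p log(q_p) + (4/l)·Σ_p log(p) + (20/3)·l*_mod·Σ_p ι_p}`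
(Steps (v), (viii), pp. 29–30 — WITHOUT the archimedean `(l+5)/4·log(π)`, which `𝕃` does not carry), by
abc-iut-S3's `Thm110Local.DstLocal.procAvg_le_of_wavg_bounds` at each `p`. [claim: Mochizuki2012, status: disputed] -/
theorem negLogThetaDH_le_of_wavg_bounds {dst : Finset ℕ} (hdst : dst ⊆ D.T)
    (Dloc : (p : ℕ) → DstLocal (placesOver F p))
    (hlam : ∀ p ∈ dst, ∀ v, (Dloc p).lam v = localDegree F v.1) {lmod : ℝ} (hlmod : 0 ≤ lmod)
    (hwavg : ∀ p ∈ dst, ∀ j, 1 ≤ j → j ≤ D.X.lstar →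
      @DstLocal.wavg _ _ (Dloc p) (j + 1) (fun e => D.M.logμ (D.M.hullUTheta D.ind3 p j e)) ≤
        ((j : ℝ) + 1) * (Dloc p).avg (Dloc p).logDK
          - (j : ℝ) ^ 2 / (2 * (2 * (D.X.lstar : ℝ) + 1)) * (Dloc p).avg (Dloc p).logQ + (Dloc p).logp
          + 4 * ((j : ℝ) + 1) * ((Dloc p).iota * lmod))
    (hoff : ∀ p ∈ D.T, p ∉ dst → ∀ j, 1 ≤ j → j ≤ D.X.lstar → ∀ e,
      D.M.logμ (D.M.hullUTheta D.ind3 p j e) ≤ 0) :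
    D.negLogThetaDH ≤
      ((2 * (D.X.lstar : ℝ) + 1) + 1) / 4 *
        ((1 + 4 / (2 * (D.X.lstar : ℝ) + 1)) * (∑ p ∈ dst, (Dloc p).avg (Dloc p).logDK)
          - 1 / 6 * (∑ p ∈ dst, (Dloc p).avg (Dloc p).logQ)
          + 4 / (2 * (D.X.lstar : ℝ) + 1) * (∑ p ∈ dst, (Dloc p).logp)
          + 20 / 3 * lmod * (∑ p ∈ dst, (Dloc p).iota)) := by
  have h0 := D.negLogThetaDH_le_sum_dst hdst Dloc hlam hoff
  have hsum : (∑ p ∈ dst, procAvg D.X.lstar (fun j =>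
      @DstLocal.wavg _ _ (Dloc p) (j + 1) (fun e => D.M.logμ (D.M.hullUTheta D.ind3 p j e)))) ≤
      ∑ p ∈ dst, ((2 * (D.X.lstar : ℝ) + 1) + 1) / 4 *
        ((1 + 4 / (2 * (D.X.lstar : ℝ) + 1)) * (Dloc p).avg (Dloc p).logDK
          - 1 / 6 * (Dloc p).avg (Dloc p).logQ + 4 / (2 * (D.X.lstar : ℝ) + 1) * (Dloc p).logp
          + 20 / 3 * ((Dloc p).iota * lmod)) := by
    refine Finset.sum_le_sum fun p hp => ?_
    haveI : Fact p.Prime := ⟨D.T_prime p (hdst hp)⟩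
    haveI : Nonempty (placesOver F p) := nonempty_placesOver p
    exact procAvg_le_of_wavg_bounds_aux (Dloc p) D.X.two_le_lstar hlmod _ (hwavg p hp)
  rw [sum_lin] at hsum
  have e : ∑ p ∈ dst, (Dloc p).iota * lmod = lmod * ∑ p ∈ dst, (Dloc p).iota := by
    rw [Finset.mul_sum]; exact Finset.sum_congr rfl fun p _ => mul_comm _ _
  rw [e] at hsum
  linarith

/-- **The same from the PER-COLLECTION bounds of Step (v)** (p. 27–28: for every collection `{v_i}_{i∈S±_{j+1}}`
the hull component is at most "`(−λ + d_I + 1)·log(p) + 4(j+1)·l*_mod`", abc-iut-S3's `DstLocal.collBound`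
with the `q`-term at the last slot), by `Thm110Local.DstLocal.procAvg_wavg_le` at each `p`.
[claim: Mochizuki2012, status: disputed] -/
theorem negLogThetaDH_le_of_collBounds {dst : Finset ℕ} (hdst : dst ⊆ D.T)
    (Dloc : (p : ℕ) → DstLocal (placesOver F p))
    (hlam : ∀ p ∈ dst, ∀ v, (Dloc p).lam v = localDegree F v.1) {lmod : ℝ} (hlmod : 0 ≤ lmod)
    (hvol : ∀ p ∈ dst, ∀ j, 1 ≤ j → j ≤ D.X.lstar → ∀ e,
      D.M.logμ (D.M.hullUTheta D.ind3 p j e) ≤ (Dloc p).collBound (2 * (D.X.lstar : ℝ) + 1) lmod j e)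
    (hoff : ∀ p ∈ D.T, p ∉ dst → ∀ j, 1 ≤ j → j ≤ D.X.lstar → ∀ e,
      D.M.logμ (D.M.hullUTheta D.ind3 p j e) ≤ 0) :
    D.negLogThetaDH ≤
      ((2 * (D.X.lstar : ℝ) + 1) + 1) / 4 *
        ((1 + 4 / (2 * (D.X.lstar : ℝ) + 1)) * (∑ p ∈ dst, (Dloc p).avg (Dloc p).logDK)
          - 1 / 6 * (∑ p ∈ dst, (Dloc p).avg (Dloc p).logQ)
          + 4 / (2 * (D.X.lstar : ℝ) + 1) * (∑ p ∈ dst, (Dloc p).logp)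
          + 20 / 3 * lmod * (∑ p ∈ dst, (Dloc p).iota)) := by
  have h0 := D.negLogThetaDH_le_sum_dst hdst Dloc hlam hoff
  have hsum : (∑ p ∈ dst, procAvg D.X.lstar (fun j =>
      @DstLocal.wavg _ _ (Dloc p) (j + 1) (fun e => D.M.logμ (D.M.hullUTheta D.ind3 p j e)))) ≤
      ∑ p ∈ dst, ((2 * (D.X.lstar : ℝ) + 1) + 1) / 4 *
        ((1 + 4 / (2 * (D.X.lstar : ℝ) + 1)) * (Dloc p).avg (Dloc p).logDK
          - 1 / 6 * (Dloc p).avg (Dloc p).logQ + 4 / (2 * (D.X.lstar : ℝ) + 1) * (Dloc p).logp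
          + 20 / 3 * ((Dloc p).iota * lmod)) := by
    refine Finset.sum_le_sum fun p hp => ?_
    haveI : Fact p.Prime := ⟨D.T_prime p (hdst hp)⟩
    haveI : Nonempty (placesOver F p) := nonempty_placesOver p
    exact (Dloc p).procAvg_wavg_le D.X.two_le_lstar hlmod _ (hvol p hp)
  rw [sum_lin] at hsum
  have e : ∑ p ∈ dst, (Dloc p).iota * lmod = lmod * ∑ p ∈ dst, (Dloc p).iota := by
    rw [Finset.mul_sum]; exact Finset.sum_congr rfl fun p _ => mul_comm _ _
  rw [e] at hsum
  linarith

end DHData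

end Summit.ABC.IUTFork

end
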